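import Summits.CriticalPhenomena.PercolationContinuityZ3.Theorems.Transplant.PlanarSkeletonFrmFromDefs
import Summits.CriticalPhenomena.PercolationContinuityZ3.Theorems.Transplant.SkelFrmFromBChoiceAtQ
import Summits.CriticalPhenomena.PercolationContinuityZ3.Theorems.Transplant.SkelFrmBChoiceAtQ
import Summits.CriticalPhenomena.PercolationContinuityZ3.Theorems.Transplant.SkelPhiCylBall
import HarnessLib
import Summits.CriticalPhenomena.PercolationContinuityZ3.Theorems.Transplant.SkelFrmBChoiceZone
/-!
# U-WAVE PORT (RULING D-U, lead g21 2026-08-26; WAVE-U-MANIFEST v3.0 row «SkelFrmBChoiceZone» ↦ «SkelFrmFromBChoiceZone») of the tree module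
# `Transplant/SkelFrmBChoiceZone` onto the carrier `PlanarSkeletonFrmFrom` (frames only, cylinders connected from width `ℓ₀` on)

ORIGINAL TITLE: N2 (frames-only node `SamePDropOfSkeletonFrm₁`, OPEN), WAVE 1: THE ZONE FACTS AT `AtQNQ` OF THE CHOICES OF RECORD — `hzconn_of_atQ`, `hkz_of_atQ`

builds on p205010 (kernel theorem, internal audit signed; external expert review pending) — nothing in this file uses p205010; NOTHING is claimed about the
OPEN node U `SamePDropOfSkeletonFrmFrom₁` (nor U_s / the end state).  Lane `prim-bschramm`, seat `prim-hp-8 gen 53 (U-wave port pen, family P-hp8; tool of record = p3-g26 port_u.py)`; helper file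
(`--supports stmt-CriticalPhenomena-4575 --as helper`).  PORT RULES r1–r4 of RULING D-U: declaration order and proof texts are those of the original,
byte-identical except (i) the carrier token `PlanarSkeletonFrm ↦ PlanarSkeletonFrmFrom` (binders, `namespace`/`end` lines, qualified names of twinned
declarations), (ii) carrier-FREE declarations of the original (φ-level `Skelφ…` blocks and namespace-only arithmetic residents) are NOT re-declared —
this file imports the original and `export`s the twin-free residents (POLICY T / treatment (m1)); residents whose statement mentions a twinned
constant are copied, (iii) every carrier-binding declaration keeps its explicit binder `(Φ : PlanarSkeletonFrmFrom G)` in its own signature (r2).  Docstrings and citations are the original's.  Manifest row idx 61 (level 10; flags verbatim); filed by the hp-8 lineage under RULING M-11 (family P-hp8).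
-/

noncomputable section

open scoped Classical

namespace Summit.CriticalPhenomena.PercolationContinuityZ3.Theorems.Transplant

open MeasureTheory Literature.Probability.Percolation Literature.Probability.LatticeModels SimpleGraph KNCells

namespace PlanarSkeletonFrmFrom

open SkelConc (Consts)
open Skelφ (oriφ trφ)
open Skelφ.StepI (DataN DataNS OutNS)

namespace NegB

open Neg

section AtQ

variable {κ : Consts} {V : Type} [DecidableEq V] [Countable V] {G : SimpleGraph V} [G.LocallyFinite] {Φ : PlanarSkeletonFrmFrom G} {t : V} {p : unitInterval}
  {hC : Φ.CylSubcritical p} {gv fv : Neg.FSlot} {Pv : PSlot} {Sv : SSlot} {cv : CSlot} {bv : BSlot} {O : OutNS V} {q : unitInterval}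

/-- **`hzconn`**: the `M_u`-zone is connected from its centre INSIDE ITSELF — `Λ c M_u = fatSeq c M_u = cylBall c M_u (fatRadius M_u)` and `pathIn_cylBall`. [folklore] -/
theorem hzconn_of_atQ {κ : Consts} {V : Type} [DecidableEq V] [Countable V] {G : SimpleGraph V} [G.LocallyFinite] {Φ : PlanarSkeletonFrmFrom G} {t : V} {p : unitInterval} {hC : Φ.CylSubcritical p} {gv : Neg.FSlot} {fv : Neg.FSlot} {Pv : PSlot} {Sv : SSlot} {cv : CSlot} {bv : BSlot} {O : OutNS V} {q : unitInterval} (hAt : (choiceAtQ3 κ Φ t p Pv gv fv Sv cv bv hC).AtQNQ O q) :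
    ∀ c, ∀ s ∈ O.merged.Λ c (Mu O.merged), PathIn G (↑(O.merged.Λ c (Mu O.merged)) : Set V) c s := by
  intro c s hs
  obtain ⟨-, -, -, -, hΛeq⟩ := Skelφ.StepI.OutO.FactsO.seed hAt.1.factsO
  have e : O.merged.Λ c (Mu O.merged) = Skelφ.fatSeq Φ.frame hC c (Mu O.merged) := congrFun (congrFun hΛeq c) _
  have eset : (↑(O.merged.Λ c (Mu O.merged)) : Set V) = Skelφ.cylBall G Φ.φ c (Mu O.merged) (Skelφ.fatRadius Φ.frame hC (Mu O.merged)) := by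
    ext v; rw [Finset.mem_coe, e, Skelφ.mem_fatSeq_iff]
  rw [eset]
  have hs' : s ∈ Skelφ.cylBall G Φ.φ c (Mu O.merged) (Skelφ.fatRadius Φ.frame hC (Mu O.merged)) := by
    rw [e, Skelφ.mem_fatSeq_iff] at hs; exact hs
  exact Skelφ.pathIn_cylBall (G := G) (φ := Φ.φ) hs'

omit [DecidableEq V] in
/-- **`hkz`** at `kz := M_u`: `1 ≤ M_u` (`1 ≤ k ≤ M₀ ≤ M_u`). [folklore] -/
theorem hkz_of_atQ {κ : Consts} {V : Type} [Countable V] {G : SimpleGraph V} [G.LocallyFinite] {Φ : PlanarSkeletonFrmFrom G} {t : V} {p : unitInterval} {hC : Φ.CylSubcritical p} {gv : Neg.FSlot} {fv : Neg.FSlot} {Pv : PSlot} {Sv : SSlot} {cv : CSlot} {bv : BSlot} {O : OutNS V} {q : unitInterval} [DecidableEq V] (hAt : (choiceAtQ3 κ Φ t p Pv gv fv Sv cv bv hC).AtQNQ O q) : 1 ≤ Mu O.merged := by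
  obtain ⟨-, h1k, hkM, -, -⟩ := Skelφ.StepI.OutO.FactsO.seed hAt.1.factsO
  exact le_trans h1k (le_trans hkM (M₀_le_Mu O.merged))

/-- **`hcz`**: every centre lies in its own `M_u`-zone — `Λ c M_u = fatSeq c M_u ∋ c` (`self_mem_cylBall`); two-liner of p1-g17 (INBOX 2026-08-23T04:26:26Z,
farm-checked there), landed here with the other zone rows. [folklore] -/
theorem hcz_of_atQ {κ : Consts} {V : Type} [DecidableEq V] [Countable V] {G : SimpleGraph V} [G.LocallyFinite] {Φ : PlanarSkeletonFrmFrom G} {t : V} {p : unitInterval} {hC : Φ.CylSubcritical p} {gv : Neg.FSlot} {fv : Neg.FSlot} {Pv : PSlot} {Sv : SSlot} {cv : CSlot} {bv : BSlot} {O : OutNS V} {q : unitInterval} (hAt : (choiceAtQ3 κ Φ t p Pv gv fv Sv cv bv hC).AtQNQ O q) (c : V) : c ∈ O.merged.Λ c (Mu O.merged) := by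
  obtain ⟨-, -, -, -, hΛeq⟩ := Skelφ.StepI.OutO.FactsO.seed hAt.1.factsO
  have hΛ : O.merged.Λ c (Mu O.merged) = Skelφ.fatSeq Φ.frame hC c (Mu O.merged) := congrFun (congrFun hΛeq c) (Mu O.merged)
  rw [hΛ, Skelφ.mem_fatSeq_iff]
  exact Skelφ.self_mem_cylBall G Φ.φ c _ _

/-- **`hcz` at every level**: `c ∈ Λ c k` for all `k` (`Λ = fatSeq` at every level by `FactsO.seed`). [folklore] -/
theorem hczAt_of_atQ {κ : Consts} {V : Type} [DecidableEq V] [Countable V] {G : SimpleGraph V} [G.LocallyFinite] {Φ : PlanarSkeletonFrmFrom G} {t : V} {p : unitInterval} {hC : Φ.CylSubcritical p} {gv : Neg.FSlot} {fv : Neg.FSlot} {Pv : PSlot} {Sv : SSlot} {cv : CSlot} {bv : BSlot} {O : OutNS V} {q : unitInterval} (hAt : (choiceAtQ3 κ Φ t p Pv gv fv Sv cv bv hC).AtQNQ O q) (c : V) (k : ℕ) : c ∈ O.merged.Λ c k := by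
  obtain ⟨-, -, -, -, hΛeq⟩ := Skelφ.StepI.OutO.FactsO.seed hAt.1.factsO
  have hΛ : O.merged.Λ c k = Skelφ.fatSeq Φ.frame hC c k := congrFun (congrFun hΛeq c) k
  rw [hΛ, Skelφ.mem_fatSeq_iff]
  exact Skelφ.self_mem_cylBall G Φ.φ c _ _

end AtQ

end NegB

end PlanarSkeletonFrmFrom

end Summit.CriticalPhenomena.PercolationContinuityZ3.Theorems.Transplant

end
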